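import Mathlib
import HarnessLib
import Summits.Ventures.LatticeQCDFlow.Scaling.IdentityFlowAcceptanceDiagonalLimit

/-!
# LatticeQCDFlow / Scaling — THE BRIDGE: any log-weight sequence converging in distribution to
# `N(−s/2, s)` with bounded mean weight has IMH acceptance converging to the log-normal law

HONEST FRAMING: exact (Metropolis-corrected) sampling algorithms for lattice gauge theory;
figures of merit are autocorrelation/cost numbers at stated couplings and volumes; no
continuum-physics claim.

Venture `LatticeQCDFlow` (cell pub-lqcd), topic `Scaling`; FANOUT row 3 (`s0-u1-a`, S0-B
implementation A, GEN-19).  NEW WORK of the cell (plumbing over row 3's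
`Scaling/IdentityFlowAcceptanceDiagonalLimit` §1: product laws, second-moment uniform integrability);
NO definition is introduced; nothing is cited.

## The statement

Exact flow-MCMC is the independence sampler with weight `w = e^{L}`; its equilibrium acceptance is
`E min(w, w′) = ∫∫ min(e^{L(ω)}, e^{L(ω′)}) dP(ω) dP(ω′)` over two INDEPENDENT draws of the log-weight
(row 3's functional throughout the `Scaling/` acceptance files, once the weight is normalised).
**`meanAccept_tendsto_of_tendstoInDistribution`**: if `L_n ⇒ N(−s/2, s)` in distribution (the laws may
live on varying probability spaces) and the mean weights `E e^{L_n}` stay bounded, then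
`E min(e^{L_n}, e^{L_n′}) → ∫∫ min(e^x, e^y) dN(−s/2, s)(x) dN(−s/2, s)(y)` (`= erfc(√s/2)`,
`Scoring/IMHLogNormalAcceptance`).  Second moments come for free: `min(a, b)² ≤ ab`, so
`E min(w, w′)² ≤ (E w)²`.  This is the one bridge every central limit theorem for a log-weight
(factorised rows — row 3's `LogNormalUniversality`; martingale / autoregressive increments — the
cell's `Scoring/MartingaleArrayCLT`; Markov-chain functionals) crosses to reach the scorers'
log-normal acceptance law.

## Content (all `[ours]`)

* `min_exp_prod_facts'` — for a law `μ` on `ℝ` with `e^{u} ∈ L¹(μ)`: `F = min(e^{u}, e^{v})` is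
  integrable and square integrable on `μ ⊗ μ` with `∫ F² ≤ (∫ e^{u} dμ)²`;
* **`integral_prod_min_exp_tendsto`** — laws `μ_n ⇒ N(−s/2, s)` weakly with `∫ e^{u} dμ_n ≤ B`
  ⇒ `∫ min(e^u, e^v) d(μ_n⊗μ_n) → ∫ min(e^u, e^v) d(N(−s/2,s)⊗N(−s/2,s))`;
* **`meanAccept_tendsto_of_tendstoInDistribution`** — the random-variable form on probability
  spaces `(Ω_n, P_n)`: `L_n ⇒ Z ∼ N(−s/2, s)`, `∫ e^{L_n} dP_n ≤ B` ⇒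
  `∫∫ min(e^{L_n(ω)}, e^{L_n(ω′)}) dP_n dP_n → ∫∫ min(e^x, e^y) d(noiseLaw s)²`.

NOT CLAIMED: which `L_n` satisfy the hypothesis (that is the business of the CLT files); rates.
-/

noncomputable section

namespace Summit.Ventures.LatticeQCDFlow.Theory2

open MeasureTheory ProbabilityTheory Filter Finset Real Set
open scoped Topology NNReal
open Literature.Probability.Distributions.PseudoMarginalNoise

/-- For a law `μ` on `ℝ` with `e^{u} ∈ L¹(μ)`: `min(e^u, e^v)` is integrable and square integrable on
`μ ⊗ μ`, with `∫ min(e^u, e^v)² d(μ⊗μ) ≤ (∫ e^u dμ)²` (since `min(a,b)² ≤ ab`). [ours] -/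
theorem min_exp_prod_facts' (μ : Measure ℝ) [IsProbabilityMeasure μ]
    (h1 : Integrable (fun u => Real.exp u) μ) :
    Integrable (fun z : ℝ × ℝ => min (Real.exp z.1) (Real.exp z.2)) (μ.prod μ)
      ∧ MemLp (fun z : ℝ × ℝ => min (Real.exp z.1) (Real.exp z.2)) 2 (μ.prod μ)
      ∧ ∫ z, (min (Real.exp z.1) (Real.exp z.2)) ^ 2 ∂(μ.prod μ) ≤ (∫ u, Real.exp u ∂μ) ^ 2 := by
  have hFc : Continuous fun z : ℝ × ℝ => min (Real.exp z.1) (Real.exp z.2) := by fun_prop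
  have hFm := hFc.aestronglyMeasurable (μ := μ.prod μ)
  have hF0 : ∀ z : ℝ × ℝ, 0 < min (Real.exp z.1) (Real.exp z.2) := fun z =>
    lt_min (Real.exp_pos _) (Real.exp_pos _)
  have hle1 : ∀ z : ℝ × ℝ, ‖min (Real.exp z.1) (Real.exp z.2)‖ ≤ Real.exp z.1 := fun z => by
    rw [Real.norm_eq_abs, abs_of_pos (hF0 z)]; exact min_le_left _ _
  have hle2 : ∀ z : ℝ × ℝ, ‖(min (Real.exp z.1) (Real.exp z.2)) ^ 2‖ ≤ Real.exp z.1 * Real.exp z.2 :=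
    fun z => by
    rw [Real.norm_eq_abs, abs_of_nonneg (sq_nonneg _), sq]
    exact mul_le_mul (min_le_left _ _) (min_le_right _ _) (hF0 z).le (Real.exp_pos _).le
  have hI1 : Integrable (fun z : ℝ × ℝ => Real.exp z.1) (μ.prod μ) := h1.comp_fst μ
  have hI2 : Integrable (fun z : ℝ × ℝ => Real.exp z.1 * Real.exp z.2) (μ.prod μ) := h1.mul_prod h1
  have hint : Integrable (fun z : ℝ × ℝ => min (Real.exp z.1) (Real.exp z.2)) (μ.prod μ) :=
    hI1.mono' hFm (Filter.Eventually.of_forall hle1)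
  have hint2 : Integrable (fun z : ℝ × ℝ => (min (Real.exp z.1) (Real.exp z.2)) ^ 2) (μ.prod μ) :=
    hI2.mono' (hFm.pow 2) (Filter.Eventually.of_forall hle2)
  refine ⟨hint, (memLp_two_iff_integrable_sq hFm).2 hint2, ?_⟩
  calc ∫ z, (min (Real.exp z.1) (Real.exp z.2)) ^ 2 ∂(μ.prod μ)
      ≤ ∫ z : ℝ × ℝ, Real.exp z.1 * Real.exp z.2 ∂(μ.prod μ) :=
        integral_mono_of_nonneg (Filter.Eventually.of_forall fun z => sq_nonneg _) hI2
          (Filter.Eventually.of_forall fun z => (le_abs_self _).trans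
            (by simpa only [Real.norm_eq_abs] using hle2 z))
    _ = (∫ u, Real.exp u ∂μ) ^ 2 := by
        rw [integral_prod_mul (fun u : ℝ => Real.exp u) (fun u : ℝ => Real.exp u), sq]

/-- **Product-law form of the bridge**: laws `μ_n ⇒ N(−s/2, s)` weakly on `ℝ` with `∫ e^u dμ_n ≤ B`
give `∫ min(e^u, e^v) d(μ_n ⊗ μ_n) → ∫ min(e^u, e^v) d(N(−s/2, s) ⊗ N(−s/2, s))`. [ours] -/
theorem integral_prod_min_exp_tendsto {μs : ℕ → ProbabilityMeasure ℝ} (s : ℝ≥0)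
    (h : Tendsto μs atTop (𝓝 ⟨noiseLaw s, inferInstance⟩)) {B : ℝ} (hB1 : 1 ≤ B)
    (hint : ∀ n, Integrable (fun u => Real.exp u) (μs n : Measure ℝ))
    (hB : ∀ n, ∫ u, Real.exp u ∂(μs n : Measure ℝ) ≤ B) :
    Tendsto (fun n => ∫ z, min (Real.exp z.1) (Real.exp z.2) ∂((μs n : Measure ℝ).prod (μs n)))
      atTop (𝓝 (∫ z, min (Real.exp z.1) (Real.exp z.2) ∂((noiseLaw s).prod (noiseLaw s)))) := by
  -- the Gaussian side: `∫ e^u dN(−s/2, s) = 1`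
  have hG1 : Integrable (fun u => Real.exp u) (noiseLaw s) := by
    have := integrable_exp_mul_gaussianReal (μ := -((s : ℝ) / 2)) (v := s) 1
    simpa [noiseLaw] using this
  have hGmean : ∫ u, Real.exp u ∂(noiseLaw s) = 1 := by
    have hm := mgf_gaussianReal (p := noiseLaw s) (X := id) (μ := -((s : ℝ) / 2)) (v := s)
      (by simp [noiseLaw]) 1
    simp only [mgf, id_eq, one_mul, mul_one, one_pow] at hm
    rw [hm]; norm_num
  have key := tendsto_integral_prod_of_tendsto (μ := ⟨noiseLaw s, inferInstance⟩) h
    (F := fun z : ℝ × ℝ => min (Real.exp z.1) (Real.exp z.2)) (by fun_prop)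
    (fun z => (lt_min (Real.exp_pos _) (Real.exp_pos _)).le) (C := B ^ 2)
    (fun n => (min_exp_prod_facts' (μs n : Measure ℝ) (hint n)).2.1)
    (fun n => ((min_exp_prod_facts' (μs n : Measure ℝ) (hint n)).2.2).trans
      (pow_le_pow_left₀ (integral_nonneg fun u => (Real.exp_pos u).le) (hB n) 2))
    ((min_exp_prod_facts' (noiseLaw s) hG1).2.1)
    (((min_exp_prod_facts' (noiseLaw s) hG1).2.2).trans (by rw [hGmean]; nlinarith))
  simpa using key

/-- **THE BRIDGE.**  On probability spaces `(Ω_n, P_n)` let the log-weights `L_n` converge in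
distribution to `Z ∼ N(−s/2, s)` and have bounded mean weights `∫ e^{L_n} dP_n ≤ B`.  Then the
equilibrium acceptance of the independence sampler over two independent draws converges to the
log-normal acceptance law: `∫∫ min(e^{L_n(ω)}, e^{L_n(ω′)}) dP_n dP_n → ∫∫ min(e^x, e^y) d(noiseLaw s)²`.
[ours] -/
theorem meanAccept_tendsto_of_tendstoInDistribution {Ω : ℕ → Type*} {mΩ : ∀ n, MeasurableSpace (Ω n)}
    {P : (n : ℕ) → Measure (Ω n)} [∀ n, IsProbabilityMeasure (P n)]
    {Ω' : Type*} {mΩ' : MeasurableSpace Ω'} {P' : Measure Ω'} [IsProbabilityMeasure P']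
    {L : (n : ℕ) → Ω n → ℝ} (hLm : ∀ n, Measurable (L n)) {Z : Ω' → ℝ} (s : ℝ≥0)
    (hZ : HasLaw Z (noiseLaw s) P') (hL : TendstoInDistribution L atTop Z P P')
    {B : ℝ} (hB1 : 1 ≤ B) (hint : ∀ n, Integrable (fun ω => Real.exp (L n ω)) (P n))
    (hB : ∀ n, ∫ ω, Real.exp (L n ω) ∂P n ≤ B) :
    Tendsto (fun n => ∫ ω, ∫ ω', min (Real.exp (L n ω)) (Real.exp (L n ω')) ∂P n ∂P n) atTop
      (𝓝 (∫ x, ∫ y, min (Real.exp x) (Real.exp y) ∂(noiseLaw s) ∂(noiseLaw s))) := by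
  haveI hPn : ∀ n, IsProbabilityMeasure ((P n).map (L n)) := fun n =>
    Measure.isProbabilityMeasure_map (hLm n).aemeasurable
  set μs : ℕ → ProbabilityMeasure ℝ := fun n => ⟨(P n).map (L n), hPn n⟩ with hμs
  have hconv : Tendsto μs atTop (𝓝 ⟨noiseLaw s, inferInstance⟩) := by
    have h := hL.tendsto
    have e : (⟨(P').map Z, Measure.isProbabilityMeasure_map hL.aemeasurable_limit⟩ : ProbabilityMeasure ℝ)
        = ⟨noiseLaw s, inferInstance⟩ := Subtype.ext hZ.map_eq
    rw [e] at h
    convert h using 2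
  have hint' : ∀ n, Integrable (fun u => Real.exp u) (μs n : Measure ℝ) := fun n =>
    (integrable_map_measure (by fun_prop) (hLm n).aemeasurable).2 (hint n)
  have hB' : ∀ n, ∫ u, Real.exp u ∂(μs n : Measure ℝ) ≤ B := fun n => by
    change ∫ u, Real.exp u ∂((P n).map (L n)) ≤ B
    rw [integral_map (hLm n).aemeasurable (by fun_prop)]
    exact hB n
  have key := integral_prod_min_exp_tendsto s hconv hB1 hint' hB'
  -- rewrite both sides as iterated integrals
  have hG1 : Integrable (fun u => Real.exp u) (noiseLaw s) := by
    have := integrable_exp_mul_gaussianReal (μ := -((s : ℝ) / 2)) (v := s) 1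
    simpa [noiseLaw] using this
  have eR : ∫ z, min (Real.exp z.1) (Real.exp z.2) ∂((noiseLaw s).prod (noiseLaw s))
      = ∫ x, ∫ y, min (Real.exp x) (Real.exp y) ∂(noiseLaw s) ∂(noiseLaw s) :=
    integral_prod _ (min_exp_prod_facts' (noiseLaw s) hG1).1
  rw [eR] at key
  refine key.congr fun n => ?_
  -- iterated integral over `P_n ⊗ P_n` = integral over the product of the laws
  obtain ⟨hintF, -, -⟩ := min_exp_prod_facts' ((P n).map (L n)) (hint' n)
  have hFc : Continuous fun z : ℝ × ℝ => min (Real.exp z.1) (Real.exp z.2) := by fun_prop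
  change ∫ z, min (Real.exp z.1) (Real.exp z.2) ∂(((P n).map (L n)).prod ((P n).map (L n))) = _
  rw [integral_prod _ hintF, integral_map (hLm n).aemeasurable]
  · refine integral_congr_ae (Filter.Eventually.of_forall fun ω => ?_)
    simp only
    rw [integral_map (hLm n).aemeasurable]
    exact (hFc.comp (Continuous.prodMk_right (L n ω))).aestronglyMeasurable
  · exact (hintF.integral_prod_left).aestronglyMeasurable

end Summit.Ventures.LatticeQCDFlow.Theory2

end
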